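import Summits.ValiantsHypothesis.ValiantsHypothesis.Theorems.BarrierLeverChowHitsPartitionMinorsRShiftCalculus

/-!
# Route BarrierLever — item `ChowHitsPartitionMinorsR` (stmt-ValiantsHypothesis-21882):
# SHIFT NORMAL FORM — the partition matrix of a product of affine forms on a lower-set layout is a unipotent sandwich of
# an explicit alternating sum; its DETERMINANT is the determinant of that sum (EXACT MD CALCULUS, matrix form)

Helper file (`--supports stmt-ValiantsHypothesis-21882`; cell valiant-natproofs, rung V4, 𝒟-side support item of route
BarrierLever; prover seat val-np-p5 gen 32; seat memo MEMO-21882-valnp5-g32.md §2(b)). Continues `…RShiftCalculus` (p731065).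
Closes NO item.

For a family of affine forms `ℓ_k = 1 + Σ_a α_{k a} x_a + Σ_c b_{k c} y_c` (`k` running over a list `l`) write `L_k = rowOp (α k)`,
`N_k = colOp (b k)` (the shift operators of p731065), `L̃_k = (1 + L_k)⁻¹ L_k`, `Ñ_k = N_k (1 + N_k)⁻¹`, and define the
**normal form** recursively by `nf [] P = P`, `nf (k :: l) P = nf l P − L̃_k · nf l P · Ñ_k`.

* `rowOp_comm`, `colOp_comm` — the shift operators of different forms COMMUTE (deleting `a` then `b` is deleting `b` then `a`);
* `pmat_mul_listProd` — **`pmat (f · ∏_{k ∈ l} ℓ_k) = U_l · nf l (pmat f) · V_l`** with `U_l = ∏ (1 + L_k)`, `V_l = ∏ (1 + N_k)`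
  unipotent (`det = 1`);
* `det_pmat_mul_listProd` — **`det pmat (f · ∏ ℓ_k) = det (nf l (pmat f))`**: the EXACT CALCULUS of the matching design in
  matrix form. With `f = ∏_a (1 + x_a + y_a)` normalised to `∏_a (1 − x_a y_a)` by free pure factors (`det_pmat_mul_pureX/Y`),
  `pmat f` is the signed identity on `R ∩ C` and `nf` unfolds to the memo's `𝕄 = Σ_K (−1)^{|K|} L̃_K E Ñ_K`.

WHAT THIS IS NOT: no determinant is evaluated here; CONJECTURE MD and item 21882 are NOT proved; nothing on crux
stmt-ValiantsHypothesis-14610 or on `VP` versus `VNP`.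
-/

set_option linter.dupNamespace false

namespace Summit.ValiantsHypothesis.ValiantsHypothesis.Theorems.BarrierLever.ChowShift

open Finset MvPolynomial

noncomputable section

variable {h r : ℕ} {S : Type*} [CommRing S]

/-! ## 1. The shift operators commute -/

/-- Collapsing the middle index of a product of two row shifts. -/
theorem rowOp_mul_rowOp_apply {u : Fin r → Finset (Fin h)} (hu : Function.Injective u)
    (hlu : IsLowerSet (Set.range u)) (α β : Fin h → S) (i i'' : Fin r) :
    (rowOp u α * rowOp u β) i i'' =
      ∑ a ∈ u i, ∑ b ∈ (u i).erase a, if u i'' = ((u i).erase a).erase b then α a * β b else 0 := by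
  classical
  rw [Matrix.mul_apply]
  simp only [rowOp, Matrix.of_apply, Finset.sum_mul]
  rw [Finset.sum_comm]
  refine Finset.sum_congr rfl fun a _ => ?_
  obtain ⟨i₀, hi₀⟩ := exists_erase_of_isLowerSet hlu i a
  rw [Finset.sum_eq_single i₀]
  · rw [if_pos hi₀, hi₀, Finset.mul_sum]
    refine Finset.sum_congr rfl fun b _ => ?_
    by_cases hb : u i'' = ((u i).erase a).erase b
    · rw [if_pos hb, if_pos hb]
    · rw [if_neg hb, if_neg hb, mul_zero]
  · intro i' _ hne
    rw [if_neg (fun e => hne (hu (e.trans hi₀.symm))), zero_mul]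
  · intro hn; exact absurd (Finset.mem_univ _) hn

/-- A double sum over ordered pairs of distinct elements is symmetric. -/
theorem sum_erase_comm {γ : Type*} [AddCommMonoid γ] (s : Finset (Fin h)) (F : Fin h → Fin h → γ) :
    (∑ a ∈ s, ∑ b ∈ s.erase a, F a b) = ∑ b ∈ s, ∑ a ∈ s.erase b, F a b := by
  classical
  have h1 : ∀ a ∈ s, (∑ b ∈ s.erase a, F a b) = ∑ b ∈ s, if b = a then 0 else F a b := by
    intro a ha
    rw [← Finset.sum_erase_add _ _ ha, if_pos rfl, add_zero]
    exact Finset.sum_congr rfl fun b hb => by rw [if_neg (Finset.ne_of_mem_erase hb)]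
  have h2 : ∀ b ∈ s, (∑ a ∈ s.erase b, F a b) = ∑ a ∈ s, if b = a then 0 else F a b := by
    intro b hb
    rw [← Finset.sum_erase_add _ _ hb, if_pos rfl, add_zero]
    exact Finset.sum_congr rfl fun a ha => by rw [if_neg (Finset.ne_of_mem_erase ha).symm]
  rw [Finset.sum_congr rfl h1, Finset.sum_congr rfl h2, Finset.sum_comm]

/-- **Row shifts commute.** -/
theorem rowOp_comm {u : Fin r → Finset (Fin h)} (hu : Function.Injective u) (hlu : IsLowerSet (Set.range u))
    (α β : Fin h → S) : rowOp u α * rowOp u β = rowOp u β * rowOp u α := by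
  ext i i''
  rw [rowOp_mul_rowOp_apply hu hlu, rowOp_mul_rowOp_apply hu hlu, sum_erase_comm]
  refine Finset.sum_congr rfl fun b _ => Finset.sum_congr rfl fun a _ => ?_
  rw [Finset.erase_right_comm, mul_comm]

/-- Collapsing the middle index of a product of two column shifts. -/
theorem colOp_mul_colOp_apply {w : Fin r → Finset (Fin h)} (hw : Function.Injective w)
    (hlw : IsLowerSet (Set.range w)) (b b' : Fin h → S) (j'' j : Fin r) :
    (colOp w b * colOp w b') j'' j =
      ∑ c ∈ w j, ∑ c' ∈ (w j).erase c, if w j'' = ((w j).erase c).erase c' then b' c * b c' else 0 := by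
  classical
  rw [Matrix.mul_apply]
  simp only [colOp, Matrix.of_apply, Finset.mul_sum]
  rw [Finset.sum_comm]
  refine Finset.sum_congr rfl fun c _ => ?_
  obtain ⟨j₀, hj₀⟩ := exists_erase_of_isLowerSet hlw j c
  rw [Finset.sum_eq_single j₀]
  · rw [if_pos hj₀, hj₀, Finset.sum_mul]
    refine Finset.sum_congr rfl fun c' _ => ?_
    by_cases hc : w j'' = ((w j).erase c).erase c'
    · rw [if_pos hc, if_pos hc, mul_comm]
    · rw [if_neg hc, if_neg hc, zero_mul]
  · intro j' _ hne
    rw [if_neg (fun e => hne (hw (e.trans hj₀.symm))), mul_zero]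
  · intro hn; exact absurd (Finset.mem_univ _) hn

/-- **Column shifts commute.** -/
theorem colOp_comm {w : Fin r → Finset (Fin h)} (hw : Function.Injective w) (hlw : IsLowerSet (Set.range w))
    (b b' : Fin h → S) : colOp w b * colOp w b' = colOp w b' * colOp w b := by
  ext j'' j
  rw [colOp_mul_colOp_apply hw hlw, colOp_mul_colOp_apply hw hlw, sum_erase_comm]
  refine Finset.sum_congr rfl fun c' _ => Finset.sum_congr rfl fun c _ => ?_
  rw [Finset.erase_right_comm, mul_comm]

/-! ## 2. The normal form -/

section NormalForm

variable {ι : Type*} (u w : Fin r → Finset (Fin h)) (α b : ι → Fin h → S)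

/-- The affine form of index `k`: `1 + Σ_a α_{k a} x_a + Σ_c b_{k c} y_c`. -/
def aff (k : ι) : MvPolynomial (Fin (h + h)) S :=
  C 1 + ∑ a, C (α k a) * X (Fin.castAdd h a) + ∑ c, C (b k c) * X (Fin.natAdd h c)

/-- `L̃_k = (1 + L_k)⁻¹ · L_k`. -/
def rowTil (k : ι) : Matrix (Fin r) (Fin r) S := (1 + rowOp u (α k))⁻¹ * rowOp u (α k)

/-- `Ñ_k = N_k · (1 + N_k)⁻¹`. -/
def colTil (k : ι) : Matrix (Fin r) (Fin r) S := colOp w (b k) * (1 + colOp w (b k))⁻¹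

/-- **The normal form**: `nf [] P = P`, `nf (k :: l) P = nf l P − L̃_k · nf l P · Ñ_k`. -/
def nf : List ι → Matrix (Fin r) (Fin r) S → Matrix (Fin r) (Fin r) S
  | [], P => P
  | k :: l, P => nf l P - rowTil u α k * nf l P * colTil w b k

/-- The left unipotent factor `U_l = (1 + L_{k₁}) ⋯ (1 + L_{kₘ})`. -/
def rowU : List ι → Matrix (Fin r) (Fin r) S
  | [] => 1
  | k :: l => (1 + rowOp u (α k)) * rowU l

/-- The right unipotent factor `V_l = (1 + N_{kₘ}) ⋯ (1 + N_{k₁})`. -/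
def colV : List ι → Matrix (Fin r) (Fin r) S
  | [] => 1
  | k :: l => colV l * (1 + colOp w (b k))

/-- Unfolding `nf` on the empty list. -/
@[simp] theorem nf_nil (P : Matrix (Fin r) (Fin r) S) : nf u w α b [] P = P := rfl
/-- Unfolding `nf` on a cons. -/
@[simp] theorem nf_cons (k : ι) (l : List ι) (P : Matrix (Fin r) (Fin r) S) :
    nf u w α b (k :: l) P = nf u w α b l P - rowTil u α k * nf u w α b l P * colTil w b k := rfl
/-- Unfolding `rowU` on the empty list. -/
@[simp] theorem rowU_nil : rowU u α ([] : List ι) = (1 : Matrix (Fin r) (Fin r) S) := rfl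
/-- Unfolding `rowU` on a cons. -/
@[simp] theorem rowU_cons (k : ι) (l : List ι) : rowU u α (k :: l) = (1 + rowOp u (α k)) * rowU u α l := rfl
/-- Unfolding `colV` on the empty list. -/
@[simp] theorem colV_nil : colV w b ([] : List ι) = (1 : Matrix (Fin r) (Fin r) S) := rfl
/-- Unfolding `colV` on a cons. -/
@[simp] theorem colV_cons (k : ι) (l : List ι) : colV w b (k :: l) = colV w b l * (1 + colOp w (b k)) := rfl

/-- `det U_l = 1`. -/
theorem det_rowU (l : List ι) : (rowU u α l).det = 1 := by
  induction l with
  | nil => simp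
  | cons k l ih => rw [rowU_cons, Matrix.det_mul, det_one_add_rowOp, ih, one_mul]

/-- `det V_l = 1`. -/
theorem det_colV (l : List ι) : (colV w b l).det = 1 := by
  induction l with
  | nil => simp
  | cons k l ih => rw [colV_cons, Matrix.det_mul, det_one_add_colOp, ih, one_mul]

variable (hu : Function.Injective u) (hw : Function.Injective w)
  (hlu : IsLowerSet (Set.range u)) (hlw : IsLowerSet (Set.range w))

include hu hlu in
/-- A row shift commutes with every `U_l`. -/
theorem rowOp_mul_rowU (β : Fin h → S) (l : List ι) : rowOp u β * rowU u α l = rowU u α l * rowOp u β := by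
  induction l with
  | nil => simp
  | cons k l ih =>
    rw [rowU_cons, ← Matrix.mul_assoc, Matrix.mul_add, Matrix.mul_one, rowOp_comm hu hlu β (α k),
      show (rowOp u β + rowOp u (α k) * rowOp u β) = (1 + rowOp u (α k)) * rowOp u β by
        rw [Matrix.add_mul, Matrix.one_mul],
      Matrix.mul_assoc, ih, ← Matrix.mul_assoc]

include hw hlw in
/-- A column shift commutes with every `V_l`. -/
theorem colV_mul_colOp (β : Fin h → S) (l : List ι) : colV w b l * colOp w β = colOp w β * colV w b l := by
  induction l with
  | nil => simp
  | cons k l ih =>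
    rw [colV_cons, Matrix.mul_assoc, Matrix.add_mul, Matrix.one_mul, colOp_comm hw hlw (b k) β,
      show (colOp w β + colOp w β * colOp w (b k)) = colOp w β * (1 + colOp w (b k)) by
        rw [Matrix.mul_add, Matrix.mul_one],
      ← Matrix.mul_assoc, ih, Matrix.mul_assoc]

/-- `(1 + L_k) · L̃_k = L_k`. -/
theorem one_add_mul_rowTil (k : ι) : (1 + rowOp u (α k)) * rowTil u α k = rowOp u (α k) := by
  unfold rowTil
  rw [← Matrix.mul_assoc, Matrix.mul_nonsing_inv _ (by rw [det_one_add_rowOp]; exact isUnit_one), Matrix.one_mul]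

/-- `Ñ_k · (1 + N_k) = N_k`. -/
theorem colTil_mul_one_add (k : ι) : colTil w b k * (1 + colOp w (b k)) = colOp w (b k) := by
  unfold colTil
  rw [Matrix.mul_assoc, Matrix.nonsing_inv_mul _ (by rw [det_one_add_colOp]; exact isUnit_one), Matrix.mul_one]

/-- The one-step identity behind the normal form: `(1+L)(M − L̃ M Ñ)(1+N) = (1+L) M (1+N) − L M N`. -/
theorem sandwich_step (k : ι) (M : Matrix (Fin r) (Fin r) S) :
    (1 + rowOp u (α k)) * (M - rowTil u α k * M * colTil w b k) * (1 + colOp w (b k)) =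
      (1 + rowOp u (α k)) * M * (1 + colOp w (b k)) - rowOp u (α k) * M * colOp w (b k) := by
  rw [Matrix.mul_sub, Matrix.sub_mul, ← Matrix.mul_assoc, ← Matrix.mul_assoc, one_add_mul_rowTil,
    Matrix.mul_assoc (rowOp u (α k) * M), colTil_mul_one_add]

include hu hw hlu hlw in
/-- **SHIFT NORMAL FORM.** `pmat (f · ∏_{k ∈ l} ℓ_k) = U_l · nf l (pmat f) · V_l`. -/
theorem pmat_mul_listProd (f : MvPolynomial (Fin (h + h)) S) (l : List ι) :
    pmat u w (f * (l.map (aff α b)).prod) = rowU u α l * nf u w α b l (pmat u w f) * colV w b l := by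
  induction l generalizing f with
  | nil => simp
  | cons k l ih =>
    rw [List.map_cons, List.prod_cons,
      show f * (aff α b k * (l.map (aff α b)).prod) = (f * (l.map (aff α b)).prod) *
          (C 1 + ∑ a, C (α k a) * X (Fin.castAdd h a) + ∑ c, C (b k c) * X (Fin.natAdd h c)) by
        unfold aff; ring]
    rw [pmat_mul_affine_one u w hu hw hlu hlw, ih, rowU_cons, colV_cons, nf_cons]
    -- move `(1 + L_k)` and `L_k` past `U_l`, `(1 + N_k)` and `N_k` past `V_l`
    set M := nf u w α b l (pmat u w f)
    set Ul := rowU u α l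
    set Vl := colV w b l
    have hLU : rowOp u (α k) * Ul = Ul * rowOp u (α k) := rowOp_mul_rowU u α hu hlu (α k) l
    have hNV : Vl * colOp w (b k) = colOp w (b k) * Vl := colV_mul_colOp w b hw hlw (b k) l
    have h1U : (1 + rowOp u (α k)) * Ul = Ul * (1 + rowOp u (α k)) := by
      rw [Matrix.add_mul, Matrix.mul_add, Matrix.one_mul, Matrix.mul_one, hLU]
    have hV1 : Vl * (1 + colOp w (b k)) = (1 + colOp w (b k)) * Vl := by
      rw [Matrix.mul_add, Matrix.add_mul, Matrix.one_mul, Matrix.mul_one, hNV]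
    calc (1 + rowOp u (α k)) * (Ul * M * Vl) * (1 + colOp w (b k)) - rowOp u (α k) * (Ul * M * Vl) * colOp w (b k)
        = Ul * ((1 + rowOp u (α k)) * M * (1 + colOp w (b k)) - rowOp u (α k) * M * colOp w (b k)) * Vl := by
          rw [Matrix.mul_sub, Matrix.sub_mul]
          congr 1
          · rw [← Matrix.mul_assoc, ← Matrix.mul_assoc, h1U, Matrix.mul_assoc (Ul * (1 + rowOp u (α k)) * M),
              hV1]
            simp only [Matrix.mul_assoc]
          · rw [← Matrix.mul_assoc, ← Matrix.mul_assoc, hLU, Matrix.mul_assoc (Ul * rowOp u (α k) * M), hNV]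
            simp only [Matrix.mul_assoc]
      _ = Ul * ((1 + rowOp u (α k)) * (M - rowTil u α k * M * colTil w b k) * (1 + colOp w (b k))) * Vl := by
          rw [sandwich_step]
      _ = (1 + rowOp u (α k)) * Ul * (M - rowTil u α k * M * colTil w b k) * (Vl * (1 + colOp w (b k))) := by
          rw [h1U, hV1]
          simp only [Matrix.mul_assoc]

include hu hw hlu hlw in
/-- **EXACT CALCULUS (determinant): `det pmat (f · ∏ ℓ_k) = det nf l (pmat f)`.** -/
theorem det_pmat_mul_listProd (f : MvPolynomial (Fin (h + h)) S) (l : List ι) :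
    (pmat u w (f * (l.map (aff α b)).prod)).det = (nf u w α b l (pmat u w f)).det := by
  rw [pmat_mul_listProd u w α b hu hw hlu hlw, Matrix.det_mul, Matrix.det_mul, det_rowU, det_colV, one_mul, mul_one]

end NormalForm

end

end Summit.ValiantsHypothesis.ValiantsHypothesis.Theorems.BarrierLever.ChowShift
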